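import Summits.QuantumFields.GaugeBoot.FreeSubgroupSU2Nat
import Summits.QuantumFields.GaugeBoot.ZdWordWalks
import HarnessLib

/-!
# Non-backtracking lattice loops are never identically trivial over `SU(N)`, `N ≥ 2`: the free configuration (gauge-boot, large-`N` supplement 16, part 2)

HONEST FRAMING (cell `pub-gaugeboot`, page 1 of every file): the venture produces certified bounds
on lattice expectations at stated coupling, gauge group, dimension and torus size; NOT a mass gap,
NOT a continuum limit, NOT a string tension; NOT large `N` unless marked CONDITIONAL; NOT
Yang–Mills-summit-bearing (barriers `FixedCouplingUltralocality`, `PerturbativeInvisibility`).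
Group theory and lattice combinatorics; this file certifies no number.

## Content

* `blockEmb k : SU 2 →* SU (2 + k)` — the block embedding `V ↦ diag(V, 1)`, an INJECTIVE homomorphism
  (`blockEmb_injective`); with part 1b: ★★ `lift_blockEmb_genNat_injective` /
  `exists_freeGroup_nat_embedding` — **`SU(N)` contains a free group of countably infinite rank for
  every `N ≥ 2`**.
* `freeConfig d k : LGConfig d (SU (2 + k))` — ONE translation-invariant configuration: every link of
  axis `μ` carries `diag(g_μ, 1)`, `g_μ = A^{μ+1} B A^{μ+1}` the free generators of part 1b.
* ★★ `wordHolonomyZd_freeConfig_ne_one` — on it, EVERY non-empty reduced word (no letter followed by its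
  inverse) has holonomy `≠ 1`, at every base point; ★★ `wordHolonomyZd_freeConfig_eq_iff` — two reduced
  words have the same holonomy on it iff they are EQUAL (based holonomies of distinct reduced words are
  distinct functions on the configuration space); ★★ `walkHolonomy_freeConfig_ne_one` — every lattice
  walk of positive length whose consecutive darts do not backtrack has holonomy `≠ 1` on it.
* Hence, for `SU(N)`, `N ≥ 2` (`exists_config_…`): ★★ `exists_config_walkHolonomy_ne_one_of_isNonBacktrackingLoop`
  — **no non-backtracking closed walk (Shen–Zhu–Zhu's `IsNonBacktrackingLoop`) has holonomy identically
  `1`**; the same for reduced / cyclically reduced words.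
* ★ THE ERRATUM OF SUPPLEMENT 9 AS A THEOREM: `wordHolonomyZd_plaqWord_self` (`plaqWord a a ε` has
  holonomy `≡ 1`) and ★★ `not_exists_isNonBacktrackingLoop_realising_plaqWord_self` — for `N ≥ 2` there is
  NO non-backtracking closed walk `γ` with `walkHolonomy U γ = wordHolonomyZd U x (plaqWord a a ε)` for all
  `U`: the plaquette-walk hypothesis `hholP r (P.rowAxis r) ε` of
  `PlanarCertificate.obj_le_bound_add_div_sq_of_szz` / `rowDefectSuN_le_of_szz` (gen 85,
  `PlanarBootstrapLargeNRate.lean`) cannot be met by any certificate with a row — exactly what the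
  erratum paragraph of that file (gen 86) states in prose; the repaired statements are in
  `PlanarBootstrapLargeNRateWords.lean`.

NOT claimed: anything about `N = 1` (there every holonomy is `1` and the hypothesis is trivially met),
about traces (Wilson loop VARIABLES of conjugate or mutually inverse words coincide), or about `SO(N)`.
[folklore] (free subgroups of compact Lie groups: Hausdorff 1914, Tits 1972; the lattice bookkeeping is
ours).
-/

noncomputable section

open Matrix SimpleGraph
open Literature.Probability.LatticeModels (Site zdGraph)
open Literature.MathematicalPhysics.QuantumLattice
open Literature.MathematicalPhysics.QuantumFieldTheory (IsNonBacktrackingLoop)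

namespace Summit.QuantumFields.GaugeBoot

variable {d : ℕ}

/-! ## The block embedding `SU(2) ↪ SU(2+k)` -/

/-- `diag(V, 1_k)` as a `(2+k) × (2+k)` matrix (Mathlib `fromBlocks` reindexed along `Fin 2 ⊕ Fin k ≃ Fin (2+k)`).
[folklore] -/
def blockMat (k : ℕ) (V : Matrix (Fin 2) (Fin 2) ℂ) : Matrix (Fin (2 + k)) (Fin (2 + k)) ℂ :=
  Matrix.reindex finSumFinEquiv finSumFinEquiv (Matrix.fromBlocks V 0 0 (1 : Matrix (Fin k) (Fin k) ℂ))

/-- `diag(1, 1) = 1`. [folklore] -/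
theorem blockMat_one (k : ℕ) : blockMat k 1 = 1 := by
  rw [blockMat, fromBlocks_one]
  exact (Matrix.reindexRingEquiv ℂ (finSumFinEquiv (m := 2) (n := k))).map_one

/-- `diag(VW, 1) = diag(V, 1) diag(W, 1)`. [folklore] -/
theorem blockMat_mul (k : ℕ) (V W : Matrix (Fin 2) (Fin 2) ℂ) : blockMat k (V * W) = blockMat k V * blockMat k W := by
  have h := (Matrix.reindexRingEquiv ℂ (finSumFinEquiv (m := 2) (n := k))).map_mul (fromBlocks V 0 0 (1 : Matrix (Fin k) (Fin k) ℂ))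
    (fromBlocks W 0 0 1)
  rw [fromBlocks_multiply] at h
  simp only [Matrix.mul_zero, Matrix.zero_mul, add_zero, zero_add, Matrix.mul_one] at h
  exact h

/-- `diag(V*, 1) = diag(V, 1)*`. [folklore] -/
theorem blockMat_star (k : ℕ) (V : Matrix (Fin 2) (Fin 2) ℂ) : blockMat k (star V) = star (blockMat k V) := by
  rw [blockMat, blockMat, star_eq_conjTranspose, star_eq_conjTranspose, Matrix.reindex_apply, Matrix.reindex_apply,
    conjTranspose_submatrix, fromBlocks_conjTranspose]
  simp

/-- `det diag(V, 1) = det V`. [folklore] -/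
theorem det_blockMat (k : ℕ) (V : Matrix (Fin 2) (Fin 2) ℂ) : (blockMat k V).det = V.det := by
  rw [blockMat, det_reindex_self, det_fromBlocks_zero₂₁, det_one, mul_one]

/-- `V ↦ diag(V, 1)` is injective. [folklore] -/
theorem blockMat_injective (k : ℕ) : Function.Injective (blockMat k) := fun V W h => by
  have h' := (Matrix.reindex (finSumFinEquiv (m := 2) (n := k)) finSumFinEquiv).injective h
  exact (fromBlocks_inj.1 h').1

/-- **The block embedding `SU(2) →* SU(2+k)`, `V ↦ diag(V, 1)`.** [folklore] -/
def blockEmb (k : ℕ) : SU 2 →* SU (2 + k) where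
  toFun V := ⟨blockMat k V.1, by
    rw [Matrix.mem_specialUnitaryGroup_iff, Matrix.mem_unitaryGroup_iff]
    refine ⟨?_, by rw [det_blockMat]; exact V.2.2⟩
    rw [← blockMat_star, ← blockMat_mul, Matrix.mem_unitaryGroup_iff.1 V.2.1, blockMat_one]⟩
  map_one' := Subtype.ext (blockMat_one k)
  map_mul' V W := Subtype.ext (blockMat_mul k V.1 W.1)

/-- Unfolding lemma. [folklore] -/
theorem coe_blockEmb (k : ℕ) (V : SU 2) : (blockEmb k V).1 = blockMat k V.1 := rfl

/-- **The block embedding is injective.** [folklore] -/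
theorem blockEmb_injective (k : ℕ) : Function.Injective (blockEmb k) := fun _ _ h =>
  Subtype.ext (blockMat_injective k (congrArg Subtype.val h))

/-- ★★ **`SU(2+k)` contains a free group of countably infinite rank**: `n ↦ diag(A^{n+1} B A^{n+1}, 1)` extends
to an injective homomorphism `FreeGroup ℕ →* SU(2+k)`. [folklore] -/
theorem lift_blockEmb_genNat_injective (k : ℕ) :
    Function.Injective (FreeGroup.lift fun n => blockEmb k (FreeSU2.genNat n)) := by
  have h : (FreeGroup.lift fun n => blockEmb k (FreeSU2.genNat n)) = (blockEmb k).comp (FreeGroup.lift FreeSU2.genNat) := by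
    ext n; simp
  rw [h, MonoidHom.coe_comp]
  exact (blockEmb_injective k).comp FreeSU2.lift_genNat_injective

/-- ★★ **For every `N ≥ 2`, `SU(N)` contains a free group of countably infinite rank** (an injective
homomorphism `FreeGroup ℕ →* SU(N)`). [folklore] -/
theorem exists_freeGroup_nat_embedding {N : ℕ} (hN : 2 ≤ N) : ∃ φ : FreeGroup ℕ →* SU N, Function.Injective φ := by
  obtain ⟨k, rfl⟩ := Nat.exists_eq_add_of_le hN
  exact ⟨_, lift_blockEmb_genNat_injective k⟩

/-! ## The free configuration -/

/-- **The free configuration** on `ℤ^d` with values in `SU(2+k)`: every link of axis `μ` carries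
`diag(g_μ, 1)`, `g_μ = A^{μ+1} B A^{μ+1}` (translation invariant). [folklore] -/
def freeConfig (d k : ℕ) : LGConfig d (SU (2 + k)) := fun e => blockEmb k (FreeSU2.genNat e.2.val)

/-- The `FreeGroup ℕ` letter of a step: (axis, orientation). [folklore] -/
def stepCode : Step d → ℕ × Bool
  | .fwd μ => (μ.val, true)
  | .bwd μ => (μ.val, false)

/-- `stepCode` is injective. [folklore] -/
theorem stepCode_injective : Function.Injective (stepCode (d := d)) := by
  intro s t h
  cases s <;> cases t <;> simp only [stepCode, Prod.mk.injEq, Bool.true_eq_false, Bool.false_eq_true, and_true,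
    and_false] at h
  · exact congrArg Step.fwd (Fin.ext h)
  · exact congrArg Step.bwd (Fin.ext h)

/-- A step's holonomy on the free configuration is `diag(g_axis^{±1}, 1)`. [folklore] -/
theorem stepHolonomyZd_freeConfig (k : ℕ) (x : Site d) (s : Step d) :
    stepHolonomyZd (freeConfig d k) x s = blockEmb k (FreeSU2.valNat (stepCode s)) := by
  cases s with
  | fwd μ => rfl
  | bwd μ => simp [freeConfig, stepCode, FreeSU2.valNat, map_inv]

/-- **A word's holonomy on the free configuration is the embedded value of its `FreeGroup ℕ` word**
(independent of the base point). [folklore] -/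
theorem wordHolonomyZd_freeConfig (k : ℕ) : ∀ (x : Site d) (w : Word d),
    wordHolonomyZd (freeConfig d k) x w = blockEmb k (((w.map stepCode).map FreeSU2.valNat).prod)
  | x, [] => by simp
  | x, s :: w => by
    rw [wordHolonomyZd_cons, wordHolonomyZd_freeConfig k (s.applyZd x) w, stepHolonomyZd_freeConfig, List.map_cons,
      List.map_cons, List.prod_cons, map_mul]

/-- A word with no letter followed by its inverse codes a REDUCED `FreeGroup ℕ` word. [folklore] -/
theorem isReduced_map_stepCode {w : Word d} (hred : w.IsChain (fun s t => t ≠ s.inv)) :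
    FreeGroup.IsReduced (w.map stepCode) := by
  rw [FreeGroup.IsReduced, List.isChain_map]
  refine hred.imp fun s t hst => ?_
  cases s with
  | fwd μ =>
    cases t with
    | fwd ν => intro _; rfl
    | bwd ν =>
      intro h
      exact absurd (congrArg Step.bwd (Fin.ext h).symm) hst
  | bwd μ =>
    cases t with
    | fwd ν =>
      intro h
      exact absurd (congrArg Step.fwd (Fin.ext h).symm) hst
    | bwd ν => intro _; rfl

/-- ★★ **On the free configuration every non-empty reduced word has holonomy `≠ 1`**, at every base point.
[folklore] -/
theorem wordHolonomyZd_freeConfig_ne_one (k : ℕ) (x : Site d) {w : Word d} (hw : w ≠ [])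
    (hred : w.IsChain (fun s t => t ≠ s.inv)) : wordHolonomyZd (freeConfig d k) x w ≠ 1 := by
  rw [wordHolonomyZd_freeConfig]
  intro h
  have h1 : ((w.map stepCode).map FreeSU2.valNat).prod = 1 :=
    blockEmb_injective k (h.trans (map_one (blockEmb k)).symm)
  exact FreeSU2.prod_valNat_ne_one (by simpa using hw) (isReduced_map_stepCode hred) h1

/-- ★★ **Reduced words are separated by the free configuration**: two reduced words have the same
holonomy on it (at any base point) iff they are equal. [folklore] -/
theorem wordHolonomyZd_freeConfig_eq_iff (k : ℕ) (x : Site d) {w w' : Word d}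
    (hred : w.IsChain (fun s t => t ≠ s.inv)) (hred' : w'.IsChain (fun s t => t ≠ s.inv)) :
    wordHolonomyZd (freeConfig d k) x w = wordHolonomyZd (freeConfig d k) x w' ↔ w = w' := by
  refine ⟨fun h => ?_, fun h => by rw [h]⟩
  rw [wordHolonomyZd_freeConfig, wordHolonomyZd_freeConfig] at h
  have h1 := FreeSU2.eq_of_prod_valNat_eq (isReduced_map_stepCode hred) (isReduced_map_stepCode hred') (blockEmb_injective k h)
  exact (List.map_injective_iff.2 stepCode_injective) h1

/-! ## Walks: consecutive darts that do not backtrack code a reduced word -/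

/-- The `FreeGroup ℕ` letter of a dart of `ℤ^d`: (axis, orientation). [folklore] -/
def dartCode (e : (zdGraph d).Dart) : ℕ × Bool := ((dartStep e).1.2.val, (dartStep e).2)

/-- The edge of a dart has the dart's axis. [folklore] -/
theorem dartStep_fst_snd (e : (zdGraph d).Dart) : (dartStep e).1.2 = dartDir e := by
  unfold dartStep; split_ifs <;> rfl

/-- A positively oriented dart goes `x → x + e_axis`. [folklore] -/
theorem snd_eq_of_dartStep_snd_eq_true {e : (zdGraph d).Dart} (h : (dartStep e).2 = true) :
    e.snd = e.fst + Pi.single (dartDir e) 1 := by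
  by_contra h'
  rw [dartStep, if_neg h'] at h
  exact Bool.false_ne_true h

/-- A negatively oriented dart goes `y + e_axis → y`. [folklore] -/
theorem fst_eq_of_dartStep_snd_eq_false {e : (zdGraph d).Dart} (h : (dartStep e).2 = false) :
    e.fst = e.snd + Pi.single (dartDir e) 1 := by
  refine (dartDir_spec e).resolve_left fun h' => ?_
  rw [dartStep, if_pos h'] at h
  exact Bool.noConfusion h

/-- A dart's holonomy on the free configuration is `diag(g_axis^{±1}, 1)`. [folklore] -/
theorem dartHolonomy_freeConfig (k : ℕ) (e : (zdGraph d).Dart) :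
    dartHolonomy (freeConfig d k) e = blockEmb k (FreeSU2.valNat (dartCode e)) := by
  unfold dartHolonomy dartCode FreeSU2.valNat freeConfig
  cases (dartStep e).2 <;> simp [map_inv]

/-- **A walk's holonomy on the free configuration is the embedded value of its dart word.** [folklore] -/
theorem walkHolonomy_freeConfig (k : ℕ) {x y : Site d} (γ : (zdGraph d).Walk x y) :
    walkHolonomy (freeConfig d k) γ = blockEmb k (((γ.darts.map dartCode).map FreeSU2.valNat).prod) := by
  have hf : dartHolonomy (freeConfig d k) = (blockEmb k) ∘ (FreeSU2.valNat ∘ dartCode) := funext (dartHolonomy_freeConfig k)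
  rw [walkHolonomy, hf, ← List.map_map, ← List.map_map, map_list_prod]

/-- **Consecutive darts with the same axis and opposite orientations backtrack.** [folklore] -/
theorem dartCode_rel_of_dartAdj {a b : (zdGraph d).Dart} (hadj : (zdGraph d).DartAdj a b) (hnb : b ≠ a.symm) :
    (dartCode a).1 = (dartCode b).1 → (dartCode a).2 = (dartCode b).2 := by
  intro hax
  have hdir : dartDir a = dartDir b := by
    rw [← dartStep_fst_snd, ← dartStep_fst_snd]; exact Fin.ext hax
  by_contra hne
  apply hnb
  rw [Dart.ext_iff, Dart.symm_toProd]
  change b.toProd = (a.snd, a.fst)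
  have hb1 : b.fst = a.snd := hadj.symm
  cases ha : (dartStep a).2 with
  | true =>
    have hb : (dartStep b).2 = false := by
      cases hb' : (dartStep b).2 with
      | false => rfl
      | true => exact absurd (ha.trans hb'.symm) hne
    have h1 := snd_eq_of_dartStep_snd_eq_true ha
    have h2 := fst_eq_of_dartStep_snd_eq_false hb
    rw [← hdir] at h2
    have hb2 : b.snd = a.fst := by rw [hb1] at h2; rw [h1] at h2; exact (add_right_cancel h2).symm
    exact Prod.ext hb1 hb2
  | false =>
    have hb : (dartStep b).2 = true := by
      cases hb' : (dartStep b).2 with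
      | true => rfl
      | false => exact absurd (ha.trans hb'.symm) hne
    have h1 := fst_eq_of_dartStep_snd_eq_false ha
    have h2 := snd_eq_of_dartStep_snd_eq_true hb
    rw [← hdir, hb1, ← h1] at h2
    exact Prod.ext hb1 h2

/-- **The dart word of a walk whose consecutive darts do not backtrack is reduced.** [folklore] -/
theorem isReduced_map_dartCode : ∀ (l : List (zdGraph d).Dart), l.IsChain (zdGraph d).DartAdj →
    l.IsChain (fun a b => b ≠ a.symm) → FreeGroup.IsReduced (l.map dartCode)
  | [], _, _ => FreeGroup.IsReduced.nil
  | [a], _, _ => FreeGroup.IsReduced.singleton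
  | a :: b :: l, hadj, hnb => by
    rw [List.isChain_cons_cons] at hadj hnb
    rw [List.map_cons, List.map_cons, FreeGroup.isReduced_cons_cons]
    exact ⟨dartCode_rel_of_dartAdj hadj.1 hnb.1, isReduced_map_dartCode (b :: l) hadj.2 hnb.2⟩

/-- ★★ **On the free configuration every walk of positive length whose consecutive darts do not backtrack
has holonomy `≠ 1`** (closed or not; no cyclic condition needed). [folklore] -/
theorem walkHolonomy_freeConfig_ne_one (k : ℕ) {x y : Site d} (γ : (zdGraph d).Walk x y) (hlen : 0 < γ.length)
    (hnb : γ.darts.IsChain (fun a b => b ≠ a.symm)) : walkHolonomy (freeConfig d k) γ ≠ 1 := by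
  rw [walkHolonomy_freeConfig]
  intro h
  have h1 : ((γ.darts.map dartCode).map FreeSU2.valNat).prod = 1 :=
    blockEmb_injective k (h.trans (map_one (blockEmb k)).symm)
  have hne : γ.darts.map dartCode ≠ [] := by
    rw [Ne, List.map_eq_nil_iff, ← List.length_eq_zero_iff, Walk.length_darts]; omega
  exact FreeSU2.prod_valNat_ne_one hne (isReduced_map_dartCode _ γ.isChain_dartAdj_darts hnb) h1

/-- ★★ **A non-backtracking closed walk (Shen–Zhu–Zhu's `IsNonBacktrackingLoop`) has holonomy `≠ 1` on the
free configuration.** [folklore] -/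
theorem walkHolonomy_freeConfig_ne_one_of_isNonBacktrackingLoop (k : ℕ) {x : Site d} (γ : (zdGraph d).Walk x x)
    (hγ : IsNonBacktrackingLoop γ) : walkHolonomy (freeConfig d k) γ ≠ 1 :=
  walkHolonomy_freeConfig_ne_one k γ hγ.1 hγ.2.left_of_append

/-! ## `SU(N)`, `N ≥ 2`: existence statements -/

/-- ★★ **For `N ≥ 2`, no non-backtracking closed walk has holonomy identically `1` over `SU(N)`.** [folklore] -/
theorem exists_config_walkHolonomy_ne_one_of_isNonBacktrackingLoop {N : ℕ} (hN : 2 ≤ N) {x : Site d}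
    (γ : (zdGraph d).Walk x x) (hγ : IsNonBacktrackingLoop γ) : ∃ U : LGConfig d (SU N), walkHolonomy U γ ≠ 1 := by
  obtain ⟨k, rfl⟩ := Nat.exists_eq_add_of_le hN
  exact ⟨freeConfig d k, walkHolonomy_freeConfig_ne_one_of_isNonBacktrackingLoop k γ hγ⟩

/-- ★★ **For `N ≥ 2`, no walk of positive length without backtracking darts has holonomy identically `1`
over `SU(N)`** (closed or open). [folklore] -/
theorem exists_config_walkHolonomy_ne_one {N : ℕ} (hN : 2 ≤ N) {x y : Site d} (γ : (zdGraph d).Walk x y)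
    (hlen : 0 < γ.length) (hnb : γ.darts.IsChain (fun a b => b ≠ a.symm)) : ∃ U : LGConfig d (SU N), walkHolonomy U γ ≠ 1 := by
  obtain ⟨k, rfl⟩ := Nat.exists_eq_add_of_le hN
  exact ⟨freeConfig d k, walkHolonomy_freeConfig_ne_one k γ hlen hnb⟩

/-- ★★ **For `N ≥ 2`, no non-empty reduced word has holonomy identically `1` over `SU(N)`.** [folklore] -/
theorem exists_config_wordHolonomyZd_ne_one {N : ℕ} (hN : 2 ≤ N) (x : Site d) {w : Word d} (hw : w ≠ [])
    (hred : w.IsChain (fun s t => t ≠ s.inv)) : ∃ U : LGConfig d (SU N), wordHolonomyZd U x w ≠ 1 := by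
  obtain ⟨k, rfl⟩ := Nat.exists_eq_add_of_le hN
  exact ⟨freeConfig d k, wordHolonomyZd_freeConfig_ne_one k x hw hred⟩

/-- **Cyclically reduced words** (the lane's `Word.CyclicallyReduced`) are in particular non-empty and
reduced, so have holonomy `≢ 1` over `SU(N)`, `N ≥ 2`. [folklore] -/
theorem exists_config_wordHolonomyZd_ne_one_of_cyclicallyReduced {N : ℕ} (hN : 2 ≤ N) (x : Site d) {w : Word d}
    (hw : w.CyclicallyReduced) : ∃ U : LGConfig d (SU N), wordHolonomyZd U x w ≠ 1 :=
  exists_config_wordHolonomyZd_ne_one hN x hw.1 hw.2.left_of_append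

/-- ★ **For `N ≥ 2`, two reduced words with the same holonomy FUNCTION over `SU(N)` are equal.** [folklore] -/
theorem eq_of_forall_wordHolonomyZd_eq {N : ℕ} (hN : 2 ≤ N) (x : Site d) {w w' : Word d}
    (hred : w.IsChain (fun s t => t ≠ s.inv)) (hred' : w'.IsChain (fun s t => t ≠ s.inv))
    (h : ∀ U : LGConfig d (SU N), wordHolonomyZd U x w = wordHolonomyZd U x w') : w = w' := by
  obtain ⟨k, rfl⟩ := Nat.exists_eq_add_of_le hN
  exact (wordHolonomyZd_freeConfig_eq_iff k x hred hred').1 (h (freeConfig d k))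

/-! ## The erratum of supplement 9 as a theorem -/

/-- **The degenerate plaquette word `plaqWord a a ε` (`= [a, a, a⁻¹, a⁻¹]` or `[a, a⁻¹, a⁻¹, a]`) has
holonomy identically `1`**, for every group and configuration. [folklore] -/
theorem wordHolonomyZd_plaqWord_self {G : Type*} [Group G] (U : LGConfig d G) (x : Site d) (a : Fin d) (ε : Bool) :
    wordHolonomyZd U x (plaqWord a a ε) = 1 := by
  cases ε <;> simp [plaqWord, stepHolonomyZd, Step.applyZd]

/-- ★★ **THE PLAQUETTE-WALK HYPOTHESIS OF SUPPLEMENT 9 IS UNSATISFIABLE for `ν = a`, `N ≥ 2`**: there is no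
non-backtracking closed walk whose holonomy agrees, on every `SU(N)` configuration, with that of
`plaqWord a a ε` — so the walk data `(γP r (P.rowAxis r) ε, hγP, hholP)` of
`PlanarCertificate.obj_le_bound_add_div_sq_of_szz` / `rowDefectSuN_le_of_szz` / `szzRateConst`
(`PlanarBootstrapLargeNRate.lean`) cannot be supplied by a certificate with at least one row; cite the
primed statements of `PlanarBootstrapLargeNRateWords.lean` instead. [folklore] -/
theorem not_exists_isNonBacktrackingLoop_realising_plaqWord_self {N : ℕ} (hN : 2 ≤ N) (x : Site d) (a : Fin d) (ε : Bool) :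
    ¬ ∃ γ : (zdGraph d).Walk x x, IsNonBacktrackingLoop γ ∧
      ∀ U : LGConfig d (SU N), walkHolonomy U γ = wordHolonomyZd U x (plaqWord a a ε) := by
  rintro ⟨γ, hγ, hhol⟩
  obtain ⟨U, hU⟩ := exists_config_walkHolonomy_ne_one_of_isNonBacktrackingLoop hN γ hγ
  exact hU ((hhol U).trans (wordHolonomyZd_plaqWord_self U x a ε))

/-- The same for EVERY word with holonomy identically `1` (e.g. the empty word, backtracks): no
non-backtracking closed walk realises it over `SU(N)`, `N ≥ 2`. [folklore] -/
theorem not_exists_isNonBacktrackingLoop_realising_trivial {N : ℕ} (hN : 2 ≤ N) (x : Site d) (w : Word d)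
    (hw : ∀ U : LGConfig d (SU N), wordHolonomyZd U x w = 1) :
    ¬ ∃ γ : (zdGraph d).Walk x x, IsNonBacktrackingLoop γ ∧ ∀ U : LGConfig d (SU N), walkHolonomy U γ = wordHolonomyZd U x w := by
  rintro ⟨γ, hγ, hhol⟩
  obtain ⟨U, hU⟩ := exists_config_walkHolonomy_ne_one_of_isNonBacktrackingLoop hN γ hγ
  exact hU ((hhol U).trans (hw U))

end Summit.QuantumFields.GaugeBoot

end
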